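import Summits.AtomisticToContinuum.Crystallization.Theorems.PhononSlackCertificatesPeriodicGivenLayeredRegistry2
import Summits.AtomisticToContinuum.Crystallization.Theorems.PhononSlackCertificatesPeriodicGivenLayeredRegistry3
import Mathlib.Analysis.Complex.ExponentialBounds
import Mathlib.Analysis.Real.Pi.Bounds

/-!
# `PeriodicGivenLayered` (stmt-AtomisticToContinuum-11779), line `Sketch`, stub `stub_registry`, helper 4

Certified numerics for the three registry certificates (card `alternating-majorisation-one-crossing`, step (5)).
With `G = θ¹_0 - θ¹_1` (unit-spacing aligned-minus-offset Gaussian layer sum) and `τ = 87/20`: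

* `reg_G_le_one`: `G(u) ≤ 1` for `u ≥ 87/20` (direct sums: `θ¹_0 ≤ ((1+r)/(1-r))²`, `r = e^{-u/2}`, and
  `θ¹_1 ≥ 3 e^{-u/3}`);
* `reg_certificate`: a generic one-point certificate `∫_0^∞ G(u) u^{m+1} (u³/τ³ - 1) e^{-su} du ≤ R` from
  elementary numerical hypotheses: on `(0, τ]` the integrand is `≤ 0` and is bounded using the first-shell lower
  bound `G(u) ≥ (18π/(√3 u)) e^{-4π²/(3u)}` (helper 3) on a level set `[t_a, t_b]` of `su + β/u`; on `[τ, ∞)` it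
  is `≥ 0` and bounded using `G ≤ 1`, `u^{m+4} ≤ τ^{m+4} e^{(m+4)(u/τ-1)}` and `∫_τ^∞ e^{-cu} = e^{-cτ}/c`.
* elementary bounds on `e^{-x}` at the few rationals that occur (`exp_neg_one_{gt,lt}_d9`, `quadratic_le_exp`).
-/

noncomputable section

namespace Summit.AtomisticToContinuum.Crystallization.Theorems.LayeredHull

open MeasureTheory Set Real Filter
open scoped BigOperators Nat
open Literature.MathematicalPhysics.StatisticalMechanics Literature.Algebra.EuclideanLattices

/-! ## `G ≤ 1` beyond `τ = 87/20` -/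

/-- Geometric form of the crude bound at unit spacing: `θ¹_0(u) ≤ ((1 + r)/(1 - r))²`, `r = e^{-u/2}`
(`‖i u + j v‖² = i² + ij + j² ≥ (i² + j²)/2` and two geometric series). [folklore] -/
theorem reg_theta_zero_le_geom {u : ℝ} (hu : 0 < u) :
    layerInteraction (fun r => Real.exp (-u * r ^ 2)) 1 0 0 0 ≤ ((1 + Real.exp (-(u / 2))) / (1 - Real.exp (-(u / 2)))) ^ 2 := by
  have hc0 : 0 < u / 2 := by positivity
  obtain ⟨hs1, hb1⟩ := reg_tsum_exp_neg_mul_sq_le hc0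
  have hs1' : Summable fun n : ℤ => ‖Real.exp (-(u / 2 * (n : ℝ) ^ 2))‖ :=
    hs1.congr fun n => (Real.norm_of_nonneg (Real.exp_pos _).le).symm
  have hpt : ∀ ij : ℤ × ℤ, Real.exp (-u * ‖layerVec 1 0 0 0 ij.1 ij.2‖ ^ 2) ≤
      Real.exp (-(u / 2 * (ij.1 : ℝ) ^ 2)) * Real.exp (-(u / 2 * (ij.2 : ℝ) ^ 2)) := fun ij => by
    rw [← Real.exp_add, Real.exp_le_exp, reg_norm_layerVec_one_sq]
    push_cast
    nlinarith [mul_nonneg hu.le (sq_nonneg ((ij.1 : ℝ) + ij.2))]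
  have hS0 : 0 ≤ ∑' n : ℤ, Real.exp (-(u / 2 * (n : ℝ) ^ 2)) := tsum_nonneg fun n => (Real.exp_pos _).le
  calc layerInteraction (fun r => Real.exp (-u * r ^ 2)) 1 0 0 0 ≤ ∑' ij : ℤ × ℤ, Real.exp (-(u / 2 * (ij.1 : ℝ) ^ 2)) * Real.exp (-(u / 2 * (ij.2 : ℝ) ^ 2)) :=
        Summable.tsum_le_tsum hpt (reg_summable_theta one_ne_zero 0 hu) (summable_mul_of_summable_norm hs1' hs1')
    _ = (∑' n : ℤ, Real.exp (-(u / 2 * (n : ℝ) ^ 2))) * ∑' n : ℤ, Real.exp (-(u / 2 * (n : ℝ) ^ 2)) :=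
        (tsum_mul_tsum_of_summable_norm hs1' hs1').symm
    _ ≤ _ := by
        rw [← sq]
        exact pow_le_pow_left₀ hS0 hb1 2

/-- The three nearest points of the offset coset: `θ¹_1(u) ≥ 3 e^{-u/3}`. [folklore] -/
theorem reg_three_mul_exp_le_theta_one {u : ℝ} (hu : 0 < u) : 3 * Real.exp (-(u / 3)) ≤ layerInteraction (fun r => Real.exp (-u * r ^ 2)) 1 0 1 0 := by
  rw [reg_theta_def]
  have hsum := Summable.sum_le_tsum ({(0, 0), (-1, 0), (0, -1)} : Finset (ℤ × ℤ)) (fun ij _ => (Real.exp_pos _).le)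
    (reg_summable_theta one_ne_zero 1 hu)
  refine le_trans (le_of_eq ?_) hsum
  rw [Finset.sum_insert (by decide), Finset.sum_insert (by decide), Finset.sum_singleton]
  have n00 : ‖layerVec 1 0 1 0 0 0‖ ^ 2 = 1 / 3 := by rw [reg_norm_layerVec_one_sq]; norm_num
  have n10 : ‖layerVec 1 0 1 0 (-1) 0‖ ^ 2 = 1 / 3 := by rw [reg_norm_layerVec_one_sq]; norm_num
  have n01 : ‖layerVec 1 0 1 0 0 (-1)‖ ^ 2 = 1 / 3 := by rw [reg_norm_layerVec_one_sq]; norm_num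
  simp only [n00, n10, n01]
  rw [show -u * (1 / 3) = -(u / 3) by ring]
  ring

/-- **`G ≤ 1` on `[87/20, ∞)`**: `θ¹_0(u) - θ¹_1(u) ≤ 1` for `u ≥ 87/20` (`4 e^{-u/6} ≤ 3 (1 - e^{-u/2})²` there,
from `e^{-u/6} ≤ e^{-7/10} ≤ 0.515` and `e^{-u/2} ≤ e^{-2} ≤ 0.1354`). [folklore] -/
theorem reg_G_le_one {u : ℝ} (hu : 87 / 20 ≤ u) : layerInteraction (fun r => Real.exp (-u * r ^ 2)) 1 0 0 0 - layerInteraction (fun r => Real.exp (-u * r ^ 2)) 1 0 1 0 ≤ 1 := by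
  have hu0 : 0 < u := by linarith
  have h0 := reg_theta_zero_le_geom hu0
  have h1 := reg_three_mul_exp_le_theta_one hu0
  set E₃ := Real.exp (-(u / 3)) with hE₃
  set E₆ := Real.exp (-(u / 6)) with hE₆
  have hr : Real.exp (-(u / 2)) = E₃ * E₆ := by rw [hE₃, hE₆, ← Real.exp_add]; ring_nf
  rw [hr] at h0
  have hE₃0 : 0 < E₃ := Real.exp_pos _
  have hE₆0 : 0 < E₆ := Real.exp_pos _
  have hE₆le : E₆ ≤ 0.515 := by
    have hq := Real.quadratic_le_exp_of_nonneg (by norm_num : (0 : ℝ) ≤ 7 / 10)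
    calc E₆ ≤ Real.exp (-(7 / 10)) := Real.exp_le_exp.2 (by linarith)
      _ = (Real.exp (7 / 10))⁻¹ := Real.exp_neg _
      _ ≤ (1 + 7 / 10 + (7 / 10) ^ 2 / 2)⁻¹ := inv_anti₀ (by norm_num) hq
      _ ≤ 0.515 := by norm_num
  have hrle : E₃ * E₆ ≤ 0.1354 := by
    rw [← hr]
    calc Real.exp (-(u / 2)) ≤ Real.exp (-2) := Real.exp_le_exp.2 (by linarith)
      _ = Real.exp (-1) ^ 2 := by rw [← Real.exp_nat_mul]; norm_num
      _ ≤ 0.3678794412 ^ 2 := pow_le_pow_left₀ (Real.exp_pos _).le Real.exp_neg_one_lt_d9.le 2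
      _ ≤ 0.1354 := by norm_num
  have hden : 0 < 1 - E₃ * E₆ := by linarith
  have key : ((1 + E₃ * E₆) / (1 - E₃ * E₆)) ^ 2 ≤ 1 + 3 * E₃ := by
    rw [div_pow, div_le_iff₀ (by positivity)]
    nlinarith [mul_pos hE₃0 hE₆0, mul_le_mul_of_nonneg_left hE₆le hE₃0.le,
      mul_le_mul_of_nonneg_left hrle hE₃0.le]
  linarith

/-! ## Elementary exponential bounds -/

/-- `0.36787944116ⁿ ≤ e^{-n}`. [folklore] -/
theorem reg_pow_le_exp_neg (n : ℕ) : (0.36787944116 : ℝ) ^ n ≤ Real.exp (-(n : ℝ)) := by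
  rw [show -(n : ℝ) = n * (-1) by ring, Real.exp_nat_mul]
  exact pow_le_pow_left₀ (by norm_num) Real.exp_neg_one_gt_d9.le n

/-- `e^{-(n + f)} ≤ 0.3678794412ⁿ / (1 + f + f²/2)` for `f ≥ 0`. [folklore] -/
theorem reg_exp_neg_le (n : ℕ) {f : ℝ} (hf : 0 ≤ f) :
    Real.exp (-((n : ℝ) + f)) ≤ (0.3678794412 : ℝ) ^ n / (1 + f + f ^ 2 / 2) := by
  have hq := Real.quadratic_le_exp_of_nonneg hf
  have hpos : 0 < 1 + f + f ^ 2 / 2 := by positivity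
  rw [neg_add, Real.exp_add, show -(n : ℝ) = n * (-1) by ring, Real.exp_nat_mul, Real.exp_neg f, div_eq_mul_inv]
  exact mul_le_mul (pow_le_pow_left₀ (Real.exp_pos _).le Real.exp_neg_one_lt_d9.le n)
    (inv_anti₀ hpos hq) (by positivity) (by positivity)

/-- `4π²/3 ≤ 13.1595` and `32.64 ≤ 18π/√3`. [folklore] -/
theorem reg_pi_bounds : 4 * π ^ 2 / 3 ≤ 26319 / 2000 ∧ (3264 / 100 : ℝ) ≤ 18 * π / Real.sqrt 3 := by
  have h1 := Real.pi_lt_d6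
  have h2 := Real.pi_gt_d6
  have hs : Real.sqrt 3 ≤ 1.7321 := by
    rw [show (1.7321 : ℝ) = Real.sqrt (1.7321 ^ 2) by rw [Real.sqrt_sq (by norm_num)]]
    exact Real.sqrt_le_sqrt (by norm_num)
  have hs0 : 0 < Real.sqrt 3 := by positivity
  refine ⟨by nlinarith [Real.pi_pos], ?_⟩
  rw [le_div_iff₀ hs0]
  nlinarith

/-! ## The generic one-point certificate -/

/-- Tail bound: for `u ≥ τ > 0`, `uⁿ e^{-su} ≤ τⁿ e^{-n} e^{-(s - n/τ) u}` (`u/τ ≤ e^{u/τ - 1}`). [folklore] -/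
theorem reg_pow_mul_exp_le {τ s u : ℝ} (hτ : 0 < τ) (hu : τ ≤ u) (n : ℕ) :
    u ^ n * Real.exp (-(u * s)) ≤ τ ^ n * (Real.exp (-(n : ℝ)) * Real.exp (-(s - n / τ) * u)) := by
  have hu0 : 0 ≤ u := hτ.le.trans hu
  have h1 : u / τ ≤ Real.exp (u / τ - 1) := by linarith [Real.add_one_le_exp (u / τ - 1)]
  have h2 : (u / τ) ^ n ≤ Real.exp (u / τ - 1) ^ n := pow_le_pow_left₀ (by positivity) h1 n
  rw [← Real.exp_nat_mul, div_pow, div_le_iff₀ (by positivity)] at h2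
  calc u ^ n * Real.exp (-(u * s)) ≤ Real.exp (n * (u / τ - 1)) * τ ^ n * Real.exp (-(u * s)) :=
        mul_le_mul_of_nonneg_right h2 (Real.exp_pos _).le
    _ = τ ^ n * (Real.exp (-(n : ℝ)) * Real.exp (-(s - n / τ) * u)) := by
        rw [mul_comm (Real.exp _) (τ ^ n), mul_assoc, ← Real.exp_add, ← Real.exp_add]
        congr 2
        field_simp
        ring

/-- A convex quadratic is non-positive between two points where it is non-positive. [folklore] -/
theorem reg_quad_nonpos {s L β ta tb u : ℝ} (hs : 0 ≤ s) (hqa : s * ta ^ 2 - L * ta + β ≤ 0)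
    (hqb : s * tb ^ 2 - L * tb + β ≤ 0) (hau : ta ≤ u) (hub : u ≤ tb) : s * u ^ 2 - L * u + β ≤ 0 := by
  rcases eq_or_lt_of_le (hau.trans hub) with heq | hlt
  · have hu : u = ta := le_antisymm (heq ▸ hub) hau
    rw [hu]
    exact hqa
  · have key : (tb - ta) * (s * u ^ 2 - L * u + β) = (s * ta ^ 2 - L * ta + β) * (tb - u) +
        (s * tb ^ 2 - L * tb + β) * (u - ta) + s * ((u - ta) * (tb - u)) * (-(tb - ta)) := by ring
    have hneg : (tb - ta) * (s * u ^ 2 - L * u + β) ≤ 0 := by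
      rw [key]
      nlinarith [mul_nonpos_of_nonpos_of_nonneg hqa (sub_nonneg.2 hub),
        mul_nonpos_of_nonpos_of_nonneg hqb (sub_nonneg.2 hau),
        mul_nonneg hs (mul_nonneg (sub_nonneg.2 hau) (sub_nonneg.2 hub))]
    nlinarith

/-- **The generic certificate.** Let `G = θ¹_0 - θ¹_1`, `τ = 87/20`, `m ∈ {1, 2}`. Suppose `s > (m+4)/τ`,
`0 < t_a ≤ t_b ≤ τ` with `s t + 13.1595/t ≤ L` at `t = t_a, t_b`, `0 ≤ C_l ≤ 18π/√3`, `E_l ≤ e^{-L}`,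
`e^{-sτ} ≤ E_u`. Then
`∫_0^∞ G(u) u^{m+1}(u³/τ³ - 1) e^{-us} du ≤ -C_l E_l P + τ^{m+1} E_u (1/(s - (m+4)/τ) - 1/s)`,
`P = (t_b^{m+1} - t_a^{m+1})/(m+1) - (t_b^{m+4} - t_a^{m+4})/((m+4) τ³)`: on `(0,τ]` the integrand is `≤ 0` and
on the level set `[t_a, t_b]` (where `su + 4π²/(3u) ≤ L`) it is `≤ -C_l E_l u^m (1 - u³/τ³)` by the first-shell
lower bound (`reg_first_shell_le`); on `[τ,∞)` it is `≤ u^{m+1}(u³/τ³ - 1) e^{-su}` (`reg_G_le_one`), bounded by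
`reg_pow_mul_exp_le` and `u^{m+1} ≥ τ^{m+1}`, and integrated in closed form. [folklore] -/
theorem reg_certificate (m : ℕ) (hm : m = 1 ∨ m = 2) {s L ta tb Cl El Eu : ℝ}
    (hs : ((m : ℝ) + 4) / (87 / 20) < s) (hta : 0 < ta) (htab : ta ≤ tb) (htb : tb ≤ 87 / 20)
    (hqa : s * ta + 26319 / 2000 / ta ≤ L) (hqb : s * tb + 26319 / 2000 / tb ≤ L)
    (hCl : Cl ≤ 18 * Real.pi / Real.sqrt 3) (hCl0 : 0 ≤ Cl) (hEl : El ≤ Real.exp (-L))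
    (hEu : Real.exp (-(87 / 20 * s)) ≤ Eu) :
    ∫ u in Set.Ioi (0 : ℝ), (layerInteraction (fun r => Real.exp (-u * r ^ 2)) 1 0 0 0 - layerInteraction (fun r => Real.exp (-u * r ^ 2)) 1 0 1 0) * (u ^ (m + 1) * (u ^ 3 / (87 / 20) ^ 3 - 1)) *
        Real.exp (-(u * s)) ≤
      -(Cl * El * ((tb ^ (m + 1) - ta ^ (m + 1)) / (m + 1) -
          (tb ^ (m + 4) - ta ^ (m + 4)) / ((m + 4) * (87 / 20) ^ 3))) +
        (87 / 20) ^ (m + 1) * Eu * (1 / (s - (m + 4) / (87 / 20)) - 1 / s) := by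
  set τ : ℝ := 87 / 20 with hτ
  have hτ0 : 0 < τ := by norm_num
  have hs0 : 0 < s := lt_trans (by positivity) hs
  have hc0 : 0 < s - (m + 4) / τ := by linarith
  obtain ⟨hβ, hC⟩ := reg_pi_bounds
  -- the integrand and its integrability
  set F : ℝ → ℝ := fun u => (layerInteraction (fun r => Real.exp (-u * r ^ 2)) 1 0 0 0 - layerInteraction (fun r => Real.exp (-u * r ^ 2)) 1 0 1 0) * (u ^ (m + 1) * (u ^ 3 / τ ^ 3 - 1)) *
    Real.exp (-(u * s)) with hF
  have hFi : IntegrableOn F (Ioi 0) := by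
    rcases hm with rfl | rfl
    · exact IntegrableOn.congr_fun (reg_integrableOn_diff_poly one_ne_zero hs0 (-1) 0 (1 / τ ^ 3) 0)
        (fun u _ => by simp only [hF]; ring) measurableSet_Ioi
    · exact IntegrableOn.congr_fun (reg_integrableOn_diff_poly one_ne_zero hs0 0 (-1) 0 (1 / τ ^ 3))
        (fun u _ => by simp only [hF]; ring) measurableSet_Ioi
  have hG0 : ∀ u, 0 < u → 0 ≤ layerInteraction (fun r => Real.exp (-u * r ^ 2)) 1 0 0 0 - layerInteraction (fun r => Real.exp (-u * r ^ 2)) 1 0 1 0 := fun u hu =>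
    sub_nonneg.2 (reg_theta_le_theta_zero one_ne_zero 1 hu)
  have hW0 : ∀ u, 0 < u → u ≤ τ → u ^ (m + 1) * (u ^ 3 / τ ^ 3 - 1) ≤ 0 := fun u hu huτ => by
    have h3 : u ^ 3 ≤ τ ^ 3 := pow_le_pow_left₀ hu.le huτ 3
    have : u ^ 3 / τ ^ 3 ≤ 1 := (div_le_one (by positivity)).2 h3
    exact mul_nonpos_of_nonneg_of_nonpos (by positivity) (by linarith)
  have hW1 : ∀ u, τ ≤ u → 0 ≤ u ^ (m + 1) * (u ^ 3 / τ ^ 3 - 1) := fun u hu => by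
    have hu0 : 0 ≤ u := hτ0.le.trans hu
    have h3 : τ ^ 3 ≤ u ^ 3 := pow_le_pow_left₀ hτ0.le hu 3
    have : 1 ≤ u ^ 3 / τ ^ 3 := (one_le_div (by positivity)).2 h3
    exact mul_nonneg (by positivity) (by linarith)
  -- split at `τ`
  have hsplit : ∫ u in Ioi (0 : ℝ), F u = (∫ u in Ioc 0 τ, F u) + ∫ u in Ioi τ, F u := by
    rw [← setIntegral_union Set.Ioc_disjoint_Ioi_same measurableSet_Ioi (hFi.mono_set Ioc_subset_Ioi_self)
      (hFi.mono_set (Ioi_subset_Ioi hτ0.le)), Ioc_union_Ioi_eq_Ioi hτ0.le]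
  -- Part 1: `(0, τ]`, shrunk to the level set `[t_a, t_b]`
  have hsub : Icc ta tb ⊆ Ioc 0 τ := fun u hu => ⟨hta.trans_le hu.1, hu.2.trans htb⟩
  have h1a : ∫ u in Ioc 0 τ, F u ≤ ∫ u in Icc ta tb, F u := by
    have h := setIntegral_mono_set (μ := volume) (f := fun u => -F u) (s := Icc ta tb) (t := Ioc 0 τ)
      (hFi.mono_set Ioc_subset_Ioi_self).neg
      ((ae_restrict_iff' measurableSet_Ioc).2 (Eventually.of_forall fun u hu => neg_nonneg.2
        (mul_nonpos_of_nonpos_of_nonneg (mul_nonpos_of_nonneg_of_nonpos (hG0 u hu.1) (hW0 u hu.1 hu.2))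
          (Real.exp_pos _).le)))
      (Eventually.of_forall hsub)
    rw [integral_neg, integral_neg] at h
    linarith
  have hqa' : s * ta ^ 2 - L * ta + 26319 / 2000 ≤ 0 := by
    have := mul_le_mul_of_nonneg_right hqa hta.le
    rw [add_mul, div_mul_cancel₀ _ hta.ne'] at this
    nlinarith
  have hqb' : s * tb ^ 2 - L * tb + 26319 / 2000 ≤ 0 := by
    have htb0 : 0 < tb := hta.trans_le htab
    have := mul_le_mul_of_nonneg_right hqb htb0.le
    rw [add_mul, div_mul_cancel₀ _ htb0.ne'] at this
    nlinarith
  have hpt1 : ∀ u ∈ Icc ta tb, F u ≤ -(Cl * El) * (u ^ m - u ^ (m + 3) / τ ^ 3) := by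
    intro u hu
    have hu0 : 0 < u := hta.trans_le hu.1
    have huτ : u ≤ τ := hu.2.trans htb
    have hq := reg_quad_nonpos hs0.le hqa' hqb' hu.1 hu.2
    have hexp : El ≤ Real.exp (-(u * s)) * Real.exp (-(4 * π ^ 2 / (3 * u))) := by
      rw [← Real.exp_add]
      refine hEl.trans (Real.exp_le_exp.2 ?_)
      have h1 : 4 * π ^ 2 / (3 * u) ≤ 26319 / 2000 / u := by
        rw [div_le_div_iff₀ (by positivity) hu0]
        nlinarith
      have h2 : u * s + 26319 / 2000 / u ≤ L := by
        have : u * s + 26319 / 2000 / u - L = (s * u ^ 2 - L * u + 26319 / 2000) / u := by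
          field_simp
          ring
        rw [← sub_nonpos, this]
        exact div_nonpos_of_nonpos_of_nonneg hq hu0.le
      linarith
    have hGl : Cl / u * Real.exp (-(4 * π ^ 2 / (3 * u))) ≤ layerInteraction (fun r => Real.exp (-u * r ^ 2)) 1 0 0 0 - layerInteraction (fun r => Real.exp (-u * r ^ 2)) 1 0 1 0 := by
      refine le_trans (mul_le_mul_of_nonneg_right ?_ (Real.exp_pos _).le) (reg_first_shell_le hu0)
      rw [div_le_div_iff₀ hu0 (by positivity)]
      rw [le_div_iff₀ (by positivity)] at hCl
      nlinarith
    have hWe : u ^ (m + 1) * (u ^ 3 / τ ^ 3 - 1) * Real.exp (-(u * s)) ≤ 0 :=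
      mul_nonpos_of_nonpos_of_nonneg (hW0 u hu0 huτ) (Real.exp_pos _).le
    have hpoly : 0 ≤ u ^ m - u ^ (m + 3) / τ ^ 3 := by
      have h3 : u ^ 3 / τ ^ 3 ≤ 1 := (div_le_one (by positivity)).2 (pow_le_pow_left₀ hu0.le huτ 3)
      have : u ^ (m + 3) / τ ^ 3 = u ^ m * (u ^ 3 / τ ^ 3) := by ring
      rw [this]
      nlinarith [pow_pos hu0 m]
    calc F u = (layerInteraction (fun r => Real.exp (-u * r ^ 2)) 1 0 0 0 - layerInteraction (fun r => Real.exp (-u * r ^ 2)) 1 0 1 0) * (u ^ (m + 1) * (u ^ 3 / τ ^ 3 - 1) * Real.exp (-(u * s))) := by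
          simp only [hF]
          ring
      _ ≤ Cl / u * Real.exp (-(4 * π ^ 2 / (3 * u))) *
          (u ^ (m + 1) * (u ^ 3 / τ ^ 3 - 1) * Real.exp (-(u * s))) := mul_le_mul_of_nonpos_right hGl hWe
      _ = -(Cl * (u ^ m - u ^ (m + 3) / τ ^ 3)) *
          (Real.exp (-(u * s)) * Real.exp (-(4 * π ^ 2 / (3 * u)))) := by
          field_simp
          ring
      _ ≤ -(Cl * (u ^ m - u ^ (m + 3) / τ ^ 3)) * El :=
          mul_le_mul_of_nonpos_left hexp (neg_nonpos.2 (mul_nonneg hCl0 hpoly))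
      _ = -(Cl * El) * (u ^ m - u ^ (m + 3) / τ ^ 3) := by ring
  have h1b : ∫ u in Icc ta tb, F u ≤ ∫ u in Icc ta tb, -(Cl * El) * (u ^ m - u ^ (m + 3) / τ ^ 3) :=
    setIntegral_mono_on (hFi.mono_set (hsub.trans Ioc_subset_Ioi_self))
      ((by fun_prop : Continuous fun u : ℝ => -(Cl * El) * (u ^ m - u ^ (m + 3) / τ ^ 3)).integrableOn_Icc)
      measurableSet_Icc hpt1
  have h1c : ∫ u in Icc ta tb, -(Cl * El) * (u ^ m - u ^ (m + 3) / τ ^ 3) =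
      -(Cl * El * ((tb ^ (m + 1) - ta ^ (m + 1)) / (m + 1) -
        (tb ^ (m + 4) - ta ^ (m + 4)) / ((m + 4) * τ ^ 3))) := by
    rw [integral_Icc_eq_integral_Ioc, ← intervalIntegral.integral_of_le htab, intervalIntegral.integral_const_mul,
      intervalIntegral.integral_sub (intervalIntegral.intervalIntegrable_pow m)
        ((intervalIntegral.intervalIntegrable_pow (m + 3)).div_const _),
      intervalIntegral.integral_div, integral_pow, integral_pow]
    have hm1 : (m : ℝ) + 1 ≠ 0 := by positivity
    have hm4 : (m : ℝ) + 3 + 1 ≠ 0 := by positivity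
    have hm4' : (m : ℝ) + 4 ≠ 0 := by positivity
    push_cast
    field_simp
    ring
  -- Part 2: `[τ, ∞)`
  have hpt2 : ∀ u ∈ Ioi τ, F u ≤ τ ^ (m + 1) * (Real.exp (-((m : ℝ) + 4)) *
      Real.exp (-(s - ((m : ℝ) + 4) / τ) * u) - Real.exp (-s * u)) := by
    intro u hu
    have hu' : τ ≤ u := le_of_lt hu
    have hu0 : 0 < u := hτ0.trans_le hu'
    have hG1 := reg_G_le_one hu'
    have hWp := hW1 u hu'
    have htail := reg_pow_mul_exp_le (s := s) hτ0 hu' (m + 4)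
    push_cast at htail
    have hlow : τ ^ (m + 1) * Real.exp (-(u * s)) ≤ u ^ (m + 1) * Real.exp (-(u * s)) :=
      mul_le_mul_of_nonneg_right (pow_le_pow_left₀ hτ0.le hu' _) (Real.exp_pos _).le
    have hes : Real.exp (-s * u) = Real.exp (-(u * s)) := by ring_nf
    calc F u = (layerInteraction (fun r => Real.exp (-u * r ^ 2)) 1 0 0 0 - layerInteraction (fun r => Real.exp (-u * r ^ 2)) 1 0 1 0) * (u ^ (m + 1) * (u ^ 3 / τ ^ 3 - 1) * Real.exp (-(u * s))) := by
          simp only [hF]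
          ring
      _ ≤ 1 * (u ^ (m + 1) * (u ^ 3 / τ ^ 3 - 1) * Real.exp (-(u * s))) :=
          mul_le_mul_of_nonneg_right hG1 (mul_nonneg hWp (Real.exp_pos _).le)
      _ = (τ ^ 3)⁻¹ * (u ^ (m + 4) * Real.exp (-(u * s))) - u ^ (m + 1) * Real.exp (-(u * s)) := by
          field_simp
          ring
      _ ≤ (τ ^ 3)⁻¹ * (τ ^ (m + 4) * (Real.exp (-((m : ℝ) + 4)) * Real.exp (-(s - ((m : ℝ) + 4) / τ) * u))) -
          τ ^ (m + 1) * Real.exp (-(u * s)) := by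
          gcongr
      _ = _ := by
          rw [hes]
          field_simp
          ring
  have hB : IntegrableOn (fun u => τ ^ (m + 1) * (Real.exp (-((m : ℝ) + 4)) *
      Real.exp (-(s - ((m : ℝ) + 4) / τ) * u) - Real.exp (-s * u))) (Ioi τ) :=
    (((exp_neg_integrableOn_Ioi τ hc0).const_mul _).sub (exp_neg_integrableOn_Ioi τ hs0)).const_mul _
  have h2a : ∫ u in Ioi τ, F u ≤ ∫ u in Ioi τ, τ ^ (m + 1) * (Real.exp (-((m : ℝ) + 4)) *
      Real.exp (-(s - ((m : ℝ) + 4) / τ) * u) - Real.exp (-s * u)) :=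
    setIntegral_mono_on (hFi.mono_set (Ioi_subset_Ioi hτ0.le)) hB measurableSet_Ioi hpt2
  have h2b : ∫ u in Ioi τ, τ ^ (m + 1) * (Real.exp (-((m : ℝ) + 4)) *
      Real.exp (-(s - ((m : ℝ) + 4) / τ) * u) - Real.exp (-s * u)) =
      τ ^ (m + 1) * Real.exp (-(τ * s)) * (1 / (s - ((m : ℝ) + 4) / τ) - 1 / s) := by
    rw [integral_const_mul, integral_sub ((exp_neg_integrableOn_Ioi τ hc0).const_mul _)
      (exp_neg_integrableOn_Ioi τ hs0), integral_const_mul, integral_exp_mul_Ioi (by linarith) τ,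
      integral_exp_mul_Ioi (by linarith) τ, neg_div_neg_eq, neg_div_neg_eq, ← mul_div_assoc]
    have e1 : Real.exp (-((m : ℝ) + 4)) * Real.exp (-(s - ((m : ℝ) + 4) / τ) * τ) = Real.exp (-(τ * s)) := by
      rw [← Real.exp_add]
      congr 1
      field_simp
      ring
    have e2 : Real.exp (-s * τ) = Real.exp (-(τ * s)) := by ring_nf
    rw [e1, e2]
    ring
  have hD : 0 ≤ 1 / (s - ((m : ℝ) + 4) / τ) - 1 / s := by
    rw [sub_nonneg]
    exact one_div_le_one_div_of_le hc0 (by linarith [show (0:ℝ) ≤ ((m : ℝ) + 4) / τ by positivity])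
  have h2c : τ ^ (m + 1) * Real.exp (-(τ * s)) * (1 / (s - ((m : ℝ) + 4) / τ) - 1 / s) ≤
      τ ^ (m + 1) * Eu * (1 / (s - ((m : ℝ) + 4) / τ) - 1 / s) :=
    mul_le_mul_of_nonneg_right (mul_le_mul_of_nonneg_left hEu (by positivity)) hD
  -- assemble
  rw [hsplit]
  linarith [h1a, h1b, h1c, h2a, h2b, h2c]

end Summit.AtomisticToContinuum.Crystallization.Theorems.LayeredHull
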